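import Mathlib
import Summits.Ventures.PercRepro.TriangleCapRowBCornerCap
import Summits.Ventures.PercRepro.TriangleCapRowTGen

/-!
# PercRepro — THE ROW `r = a − 1` ON ITS FULL RANGE `k ≥ 2a + r = 3a − 1`, EVERY `5 ≤ a ≤ 18`: the corner
`k = 3a − 1` through the corner cap of part 200k, hence the non-bipartite stability table on every cell
`r ≤ a − 1` of every row `5 ≤ a ≤ 18` for every `k ≥ 2a + r` (`k ≥ 2a + 2`) (p3, gen 47; part 200l)

`rowB_second_order_corner` is the proof of part 200i with `cap_B2_corner` in place of `cap_T_gen` (the deletions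
land on `(3a − 2, a, a − 2)` and the `B2` cells `(3a − 2, a, d − 1)`, all inside their ranges); `rowB_second_order_all`
joins it with part 200i; `rowB_nonbip_second_best_all` is the value on the full range. Axioms: standard.
-/

namespace PercRepro

namespace TriangleCap

namespace C047

open Finset

variable {V : Type*} [Fintype V] [DecidableEq V]

/-- **THE ROW `r = a − 1` AT ITS CORNER `k = 3a − 1`, `5 ≤ a ≤ 18`:** `K₄⁻`-free, `m + r = a (k − a)` ⇒ `a`-bipartite
or `Σ_v d(v)² + r (k − 1 − r) + 2 (k − 2a − 1) ≤ m k`. -/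
theorem rowB_second_order_corner (D : SimpleGraph V) [DecidableRel D.Adj] (hK : K4mFree D) (a r : ℕ)
    (ha5 : 5 ≤ a) (ha18 : a ≤ 18) (hr : r + 1 = a) (hk : Fintype.card V = 2 * a + r)
    (hm : D.edgeFinset.card + r = a * (Fintype.card V - a)) :
    (∃ A : Finset V, A.card = a ∧ BipSub D A) ∨
      ∑ v, deg D v * deg D v + r * (Fintype.card V - 1 - r) + 2 * (Fintype.card V - 2 * a - 1) ≤
        D.edgeFinset.card * Fintype.card V := by
  have hk2 : 2 * a + 2 ≤ Fintype.card V := by omega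
  -- (A) a vertex at the cap
  by_cases hx : ∃ x, deg D x + a = Fintype.card V
  · obtain ⟨x, hx⟩ := hx
    exact cap_B2_corner D hK a r ha5 hr hk hm x hx
  push Not at hx
  have hcap : ∀ v, deg D v + a ≤ Fintype.card V := fun v =>
    deg_add_le_card_of_dense D hK a (by omega) (by omega)
      (cap_arith a (Fintype.card V) D.edgeFinset.card r (by omega) (by omega)
        (below_cap_arith a (Fintype.card V) D.edgeFinset.card r (by omega) hm)) v
  have hcap' : ∀ v, deg D v + a + 1 ≤ Fintype.card V := fun v => by
    have h1 := hcap v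
    have h2 := hx v
    omega
  have hcap2 : ∀ v, deg D v ≤ (Fintype.card V - a - 2) + 1 := fun v => by have := hcap' v; omega
  -- (B) every degree `≥ a`: the window
  by_cases hdeg : ∀ v, a ≤ deg D v
  · exact Or.inr (rowT_window D a r (by omega) (by omega) (by omega) hm hcap' hdeg)
  push Not at hdeg
  obtain ⟨z, hz⟩ := hdeg
  -- (C) `d = 0`: the cross-row deletion, exactly the target
  rcases Nat.lt_or_ge (r + deg D z) a with hz1 | hz2
  · right
    have h := below_cross_gen D hK a r (by omega) hk2 hm hcap' z (by omega)
    have e : a - r = 1 := by omega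
    rw [e, mul_one] at h
    exact h
  -- (D) `1 ≤ d ≤ a − 1`: onto the cell `(k − 1, a, d − 1)`
  obtain ⟨r', hr'⟩ : ∃ r', r + deg D z = a + r' := ⟨r + deg D z - a, by omega⟩
  have hK' := k4mFree_del D hK z
  have hcard' := card_del z
  have hedges' := card_edges_del D z
  have hsq := sum_deg_sq_del D z
  have hT := sum_del_nbhd_le D z (Fintype.card V - a - 2) hcap2
  obtain ⟨T, hTdef⟩ : ∃ T, ∑ w : {v : V // v ≠ z}, (if D.Adj w.1 z then deg (del D z) w else 0) = T := ⟨_, rfl⟩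
  obtain ⟨S', hS'def⟩ : ∃ S', ∑ w : {v : V // v ≠ z}, deg (del D z) w * deg (del D z) w = S' := ⟨_, rfl⟩
  obtain ⟨m', hm'def⟩ : ∃ m', (del D z).edgeFinset.card = m' := ⟨_, rfl⟩
  rw [hTdef, hS'def] at hsq
  rw [hTdef] at hT
  rw [hm'def] at hedges'
  have hcardV' : Fintype.card {v : V // v ≠ z} = Fintype.card V - 1 := by omega
  have hm' : (del D z).edgeFinset.card + r' = a * (Fintype.card {v : V // v ≠ z} - a) := by
    rw [hm'def, hcardV']
    exact below_cell_edges a r r' (deg D z) (Fintype.card V) D.edgeFinset.card m' hk2 hr' hedges' hm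
  have hmd : m' + deg D z + r = a * (Fintype.card V - a) := by omega
  -- the side lemma, shared by every `d`
  have hside : ∀ A' : Finset {v : V // v ≠ z}, A'.card = a → BipSub (del D z) A' →
      (∃ A : Finset V, A.card = a ∧ BipSub D A) ∨
        (∑ v, deg D v * deg D v + r * (Fintype.card V - 1 - r) + 2 * (Fintype.card V - 2 * a - 1) ≤
          D.edgeFinset.card * Fintype.card V) ∨
        (T + (Fintype.card V - a - 2) ≤ deg D z * (Fintype.card V - a - 2) + a) := by
    intro A' hA'card hB
    have := sides_T_gen D a r (by omega) hk2 hm z A' hA'card hB hcap2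
    rw [hTdef] at this
    exact this
  rcases Nat.lt_or_ge (deg D z + 1) a with hda | hda
  · -- `d ≤ a − 2`: the `B2` cell `(k − 1, a, d − 1)`
    rcases below_second_order_all (del D z) hK' a r' (by omega) ha18 (by omega) (by omega) hm'
      with ⟨A', hA'card, hB⟩ | hgap
    · rcases hside A' hA'card hB with h | h | hT'
      · exact Or.inl h
      · exact Or.inr h
      · right
        rcases Nat.lt_or_ge (deg D z) 2 with hd1 | hd2
        · -- `d = 1`: the envelope read, exactly the family `B2`
          have hd1' : deg D z = 1 := by omega
          have henv := sum_deg_sq_le_of_k4mFree (del D z) hK' (by omega)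
          rw [hS'def, hm'def, hcardV'] at henv
          rw [hd1'] at hT' hedges'
          rw [hsq, ← hedges', hd1']
          exact rowB_env_arith a r (Fintype.card V) m' S' T ha5 hr (by omega) (by rw [hd1'] at hmd; exact hmd)
            henv hT'
        · have hS := sum_deg_sq_le_of_bipSub (del D z) A' hB a r' hA'card hm' (by omega)
          rw [hS'def, hm'def, hcardV'] at hS
          rw [hsq, ← hedges']
          exact rowB_mixed_arith a r r' (deg D z) (Fintype.card V) m' S' T ha5 hr hd2 (by omega) (by omega) hr'
            hmd hS hT'
    · right
      rw [hS'def, hm'def, hcardV'] at hgap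
      have h := below_within_assemble a r r' (deg D z) (Fintype.card V) m' S' T hk2 (by omega) hr' (by omega)
        hmd hgap hT
      rw [hsq, ← hedges']
      have e : a - r = 1 := by omega
      rw [e, mul_one] at h
      exact h
  · -- `d = a − 1`: the `T` cell `(k − 1, a, a − 2)`
    have hda' : deg D z = a - 1 := by omega
    have hr'' : r' = a - 2 := by omega
    subst hr''
    rcases rowT_second_order_gen (del D z) hK' a (a - 2) ha5 ha18 (by omega) (by omega) hm'
      with ⟨A', hA'card, hB⟩ | hgap
    · rcases hside A' hA'card hB with h | h | hT'
      · exact Or.inl h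
      · exact Or.inr h
      · right
        have hS := sum_deg_sq_le_of_bipSub (del D z) A' hB a (a - 2) hA'card hm' (by omega)
        rw [hS'def, hm'def, hcardV'] at hS
        rw [hsq, ← hedges']
        exact rowB_mixed_arith a r (a - 2) (deg D z) (Fintype.card V) m' S' T ha5 hr (by omega) (by omega)
          (by omega) hr' hmd hS hT'
    · right
      rw [hS'def, hm'def, hcardV'] at hgap
      rw [hda'] at hT hedges' hmd
      rw [hsq, ← hedges', hda']
      exact rowB_T_arith a r (Fintype.card V) m' S' T ha5 hr (by omega) hmd hgap hT


/-- **THE WITNESS `B2` ON THE FULL RANGE `3a − 1 ≤ k`:** `bipMinusStar k (a + 1) (k − a − 2)` is `K₄⁻`-free with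
`a (k − a) − (a − 1)` edges, is `a`-bipartite for no `A`, and attains the value. -/
theorem rowB_witness' (k a : ℕ) (ha5 : 5 ≤ a) (hk : 3 * a ≤ k + 1) :
    K4mFree (bipMinusStar k (a + 1) (k - a - 2)) ∧
      (bipMinusStar k (a + 1) (k - a - 2)).edgeFinset.card + (a - 1) = a * (k - a) ∧
      (¬ ∃ A : Finset (Fin k), A.card = a ∧ BipSub (bipMinusStar k (a + 1) (k - a - 2)) A) ∧
      ∑ v, deg (bipMinusStar k (a + 1) (k - a - 2)) v * deg (bipMinusStar k (a + 1) (k - a - 2)) v +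
          (a - 1) * (k - 1 - (a - 1)) + 2 * (k - 2 * a - 1) =
        (bipMinusStar k (a + 1) (k - a - 2)).edgeFinset.card * k := by
  have hE := card_edges_bipMinusStar k (a + 1) (k - a - 2) (by omega) (by omega)
  have hS := (sums_bipMinusStar k (a + 1) (k - a - 2) (by omega) (by omega)).2
  refine ⟨k4mFree_bipMinusStar _ _ _, ?_, not_bipSub_bipMinusStar_small k a (k - a - 2) (by omega) (by omega), ?_⟩
  · obtain ⟨q, rfl⟩ : ∃ q, a = q + 5 := ⟨a - 5, by omega⟩
    obtain ⟨c, rfl⟩ : ∃ c, k = 3 * q + 14 + c := ⟨k - (3 * q + 14), by omega⟩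
    have e1 : 3 * q + 14 + c - (q + 5 + 1) = 2 * q + 8 + c := by omega
    have e2 : 3 * q + 14 + c - (q + 5) - 2 = 2 * q + 7 + c := by omega
    have e3 : 3 * q + 14 + c - (q + 5) = 2 * q + 9 + c := by omega
    have e4 : q + 5 - 1 = q + 4 := by omega
    rw [e1, e2] at hE
    rw [e2, e3, e4]
    nlinarith [hE]
  · obtain ⟨S, hSdef⟩ : ∃ S, ∑ v, deg (bipMinusStar k (a + 1) (k - a - 2)) v *
        deg (bipMinusStar k (a + 1) (k - a - 2)) v = S := ⟨_, rfl⟩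
    obtain ⟨E, hEdef⟩ : ∃ E, (bipMinusStar k (a + 1) (k - a - 2)).edgeFinset.card = E := ⟨_, rfl⟩
    rw [hSdef] at hS
    rw [hEdef] at hE
    rw [hSdef, hEdef]
    obtain ⟨q, rfl⟩ : ∃ q, a = q + 5 := ⟨a - 5, by omega⟩
    obtain ⟨c, rfl⟩ : ∃ c, k = 3 * q + 14 + c := ⟨k - (3 * q + 14), by omega⟩
    have e1 : 3 * q + 14 + c - (q + 5 + 1) = 2 * q + 8 + c := by omega
    have e2 : 3 * q + 14 + c - (q + 5) - 2 = 2 * q + 7 + c := by omega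
    have e3 : 2 * (3 * q + 14 + c) - (2 * q + 7 + c) - 1 = 4 * q + 20 + c := by omega
    have e4 : q + 5 - 1 = q + 4 := by omega
    have e5 : 3 * q + 14 + c - 1 - (q + 4) = 2 * q + 9 + c := by omega
    have e6 : 3 * q + 14 + c - 2 * (q + 5) - 1 = q + 3 + c := by omega
    rw [e1, e2] at hE hS
    rw [e3] at hS
    rw [e4, e5, e6]
    zify at hE hS ⊢
    linear_combination hS - (3 * (q : ℤ) + 14 + c) * hE

/-- **THE ROW `r = a − 1` ON ITS FULL RANGE, `5 ≤ a ≤ 18`, `2a + r ≤ k`:** `K₄⁻`-free, `m + r = a (k − a)` ⇒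
`a`-bipartite or `Σ_v d(v)² + r (k − 1 − r) + 2 (k − 2a − 1) ≤ m k`. -/
theorem rowB_second_order_all (D : SimpleGraph V) [DecidableRel D.Adj] (hK : K4mFree D) (a r : ℕ)
    (ha5 : 5 ≤ a) (ha18 : a ≤ 18) (hr : r + 1 = a) (hk : 2 * a + r ≤ Fintype.card V)
    (hm : D.edgeFinset.card + r = a * (Fintype.card V - a)) :
    (∃ A : Finset V, A.card = a ∧ BipSub D A) ∨
      ∑ v, deg D v * deg D v + r * (Fintype.card V - 1 - r) + 2 * (Fintype.card V - 2 * a - 1) ≤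
        D.edgeFinset.card * Fintype.card V := by
  rcases Nat.lt_or_ge (Fintype.card V) (2 * a + r + 1) with hc | hc
  · exact rowB_second_order_corner D hK a r ha5 ha18 hr (by omega) hm
  · exact rowB_second_order_gen D hK a r ha5 ha18 hr hc hm

/-- **THE NON-BIPARTITE SECOND-BEST VALUE ON THE CELL `(k, a, a − 1)` ON ITS FULL RANGE `3a − 1 ≤ k`,
`5 ≤ a ≤ 18`:** EXACTLY `m k − (a − 1)(k − a) − 2 (k − 2a − 1)`, attained by the family `B2`. -/
theorem rowB_nonbip_second_best_all (k a : ℕ) (ha5 : 5 ≤ a) (ha18 : a ≤ 18) (hk : 3 * a ≤ k + 1) :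
    (∀ (D : SimpleGraph (Fin k)) [DecidableRel D.Adj], K4mFree D → D.edgeFinset.card + (a - 1) = a * (k - a) →
        (¬ ∃ A : Finset (Fin k), A.card = a ∧ BipSub D A) →
        ∑ v, deg D v * deg D v + (a - 1) * (k - 1 - (a - 1)) + 2 * (k - 2 * a - 1) ≤ D.edgeFinset.card * k) ∧
      ∃ (D : SimpleGraph (Fin k)) (_ : DecidableRel D.Adj), K4mFree D ∧ D.edgeFinset.card + (a - 1) = a * (k - a) ∧
        (¬ ∃ A : Finset (Fin k), A.card = a ∧ BipSub D A) ∧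
        ∑ v, deg D v * deg D v + (a - 1) * (k - 1 - (a - 1)) + 2 * (k - 2 * a - 1) = D.edgeFinset.card * k := by
  have hcard : Fintype.card (Fin k) = k := Fintype.card_fin k
  refine ⟨?_, ?_⟩
  · intro D _ hK hm hnb
    rcases rowB_second_order_all D hK a (a - 1) ha5 ha18 (by omega) (by rw [hcard]; omega) (by rw [hcard]; exact hm)
      with h | h
    · exact absurd h hnb
    · rw [hcard] at h
      exact h
  · obtain ⟨hK, hE, hnb, hS⟩ := rowB_witness' k a ha5 hk
    exact ⟨_, inferInstance, hK, hE, hnb, hS⟩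

end C047

end TriangleCap

end PercRepro
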